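import Mathlib
import Literature.MathematicalPhysics.QuantumFieldTheory.Luscher2010.FlowActionSeries
import Literature.MathematicalPhysics.QuantumFieldTheory.SUNBakryEmeryFrame
import Literature.MathematicalPhysics.QuantumFieldTheory.UnitaryTraceConcentration
import HarnessLib

/-!
# Lüscher 2010 — proofs: the Casimir sum `∑ₐ TᵃTᵃ = -C_F 1` of a basis of `𝔰𝔲(n)` and the plaquette Laplacian `Δ Re tr U_p = 4 C_F Re tr U_p`

M. Lüscher, *Trivializing maps, the Wilson flow and the HMC algorithm*, Commun. Math. Phys. 293 (2010)
899–919, arXiv:0907.5491 [Luscher2010Trivializing]. This file PROVES two statements that the statement files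
`Luscher2010/TrivializingMaps.lean` (file A) and `Luscher2010/FlowActionSeries.lean` (file B) only cite:

* `SuBasis.sum_mul_self` — for ANY basis `Tᵃ` of `𝔰𝔲(n)` with `tr(TᵃTᵇ) = -½δᵃᵇ` (App. A.1, (A.1)–(A.2)):
  `∑ₐ TᵃTᵃ = -C_F·1`, `C_F = (n²-1)/(2n)` — the contraction of the completeness relation (A.5). Obtained from the
  tree's Parseval frame of `𝔰𝔲(n)` (`SUNBakryEmery.sum_re_trace_smul_frame`, `SUNBakryEmery.sum_frame_mul_frame`)
  by the basis-exchange identity `∑ₐ Tᵃ ⊗ Tᵃ = ½ ∑_α Y_α ⊗ Y_α`; no choice of basis is involved.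
* `linkLap_re_trace_plaquette` / `plaquetteLaplacian_holds : PlaquetteLaplacian d L n` — on a periodic lattice
  with `L ≥ 2`, for every ambient configuration `W` and `μ ≠ ν`:
  `Δ Re tr(W(x,μ) W(x+μ̂,ν) W(x+ν̂,μ)ᴴ W(x,ν)ᴴ) = 4 C_F Re tr(same)`, `Δ = -∑_{e,a} ∂ᵃₑ∂ᵃₑ` (file A `linkLap`): each
  of the four (pairwise distinct, because `L ≥ 2` and `μ ≠ ν`) links of the plaquette contributes `∑ₐ TᵃTᵃ = -C_F`
  inserted into the trace, every other link derivative vanishes. This is the computation behind (3.10) ("the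
  Jacobian of the Wilson flow is `-16/3 ∫ S_w`" for `SU(3)`: `4 C_F = 16/3`) and (4.14) (`S̃⁽⁰⁾ ∝ S_w`: to leading
  order the trivializing flow is the Wilson flow). The cited Prop `PlaquetteLaplacian` of file B is thereby a
  theorem (`fact-discharged`); nothing in this file is new mathematics.

Authored by the pub-lqcd theory-1 seat (cell lqcd-flow); file of record
`HOME/lean/theory1/LuscherC_FlowActionSeriesProofs.lean`.

HONEST FRAMING: exact (Metropolis-corrected) sampling algorithms for lattice gauge theory; figures
of merit are autocorrelation/cost numbers at stated couplings and volumes; no continuum-physics claim.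
-/

open scoped Matrix

namespace Literature.MathematicalPhysics.QuantumFieldTheory.Luscher2010

open Literature.MathematicalPhysics.QuantumFieldTheory

variable {d L n : ℕ}

/-! ## The Casimir sum of an `SuBasis` -/

/-- Expansion in the basis: `X = ∑ₐ (-2 tr(TᵃX)) Tᵃ` for `X ∈ 𝔰𝔲(n)`, i.e. `X = XᵃTᵃ` with `Xᵃ = -2 tr(TᵃX)`
(App. A.3 (A.10)). [cite: Luscher2010Trivializing, App. A.1 eqs. (A.1)–(A.2), App. A.3 eq. (A.10)] -/
theorem SuBasis.eq_sum_trace_smul (B : SuBasis n) {X : Matrix (Fin n) (Fin n) ℂ} (hX : X ∈ suAlgebra n) :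
    X = ∑ a, (-2 * (B.T a * X).trace) • B.T a := by
  obtain ⟨c, hc⟩ := B.span X hX
  have hca : ∀ a, (B.T a * X).trace = -(1 / 2 : ℂ) * c a := by
    intro a
    rw [hc, Matrix.mul_sum, Matrix.trace_sum]
    simp_rw [Matrix.mul_smul, Matrix.trace_smul, B.orth, smul_eq_mul]
    rw [Finset.sum_eq_single a]
    · rw [if_pos rfl]; ring
    · intro b _ hb; rw [if_neg (fun h => hb h.symm)]; ring
    · intro h; exact absurd (Finset.mem_univ a) h
  conv_lhs => rw [hc]
  refine Finset.sum_congr rfl fun a _ => ?_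
  rw [hca]
  congr 1
  ring

/-- Real form of the expansion, contracted against the basis: `∑ₐ (-Re tr(X Tᵃ)) Tᵃ = ½ X` for `X ∈ 𝔰𝔲(n)`.
[cite: Luscher2010Trivializing, App. A.3 eq. (A.10)] -/
theorem SuBasis.sum_re_trace_smul (B : SuBasis n) {X : Matrix (Fin n) (Fin n) ℂ} (hX : X ∈ suAlgebra n) :
    ∑ a, (-(X * B.T a).trace.re) • B.T a = (1 / 2 : ℂ) • X := by
  have hXs := (mem_suAlgebra_iff X).1 hX
  have h1 : ∀ a, (B.T a * X).trace = (((B.T a * X).trace.re : ℝ) : ℂ) := fun a =>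
    SUNBakryEmery.trace_mul_eq_re_of_skew ((mem_suAlgebra_iff _).1 (B.mem a)).1 hXs.1
  have h2 : ∀ a, (X * B.T a).trace.re = (B.T a * X).trace.re := fun a => by
    rw [Matrix.trace_mul_comm]
  have key := B.eq_sum_trace_smul hX
  calc ∑ a, (-(X * B.T a).trace.re) • B.T a
      = ∑ a, ((1 / 2 : ℂ) * (-2 * (B.T a * X).trace)) • B.T a := by
        refine Finset.sum_congr rfl fun a _ => ?_
        rw [← Complex.coe_smul, h2 a]
        congr 1
        conv_rhs => rw [h1 a]
        push_cast
        ring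
    _ = (1 / 2 : ℂ) • ∑ a, (-2 * (B.T a * X).trace) • B.T a := by
        rw [Finset.smul_sum]
        simp_rw [smul_smul]
    _ = (1 / 2 : ℂ) • X := by rw [← key]

/-- **Casimir sum** `∑ₐ TᵃTᵃ = -C_F·1`, `C_F = (n²-1)/(2n)`, for every basis of `𝔰𝔲(n)` normalised by
`tr(TᵃTᵇ) = -½δᵃᵇ` (the contraction `b = c` of the completeness relation (A.5)). Proof by exchanging the basis
for the tree's Parseval frame `Y_α` of `𝔰𝔲(n)`: `∑ₐ TᵃTᵃ = ∑_α (∑ₐ ⟨Y_α,Tᵃ⟩Tᵃ) Y_α = ½ ∑_α Y_α Y_α`.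
[cite: Luscher2010Trivializing, App. A.1 eqs. (A.5)–(A.6)] -/
theorem SuBasis.sum_mul_self (B : SuBasis n) :
    ∑ a, B.T a * B.T a = (-(((n : ℝ) ^ 2 - 1) / (2 * n))) • (1 : Matrix (Fin n) (Fin n) ℂ) := by
  rcases Nat.eq_zero_or_pos n with hn | hn
  · subst hn
    exact Subsingleton.elim _ _
  have hN : n ≠ 0 := hn.ne'
  have hmem : ∀ a, (B.T a)ᴴ = -B.T a ∧ (B.T a).trace = 0 := fun a => (mem_suAlgebra_iff _).1 (B.mem a)
  have h1 : ∀ a, B.T a = ∑ α, (-(SUNBakryEmery.frame α * B.T a).trace.re) • SUNBakryEmery.frame α :=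
    fun a => (SUNBakryEmery.sum_re_trace_smul_frame hN (hmem a).1 (hmem a).2).symm
  have h2 : ∀ α, SUNBakryEmery.frame (N := n) α ∈ suAlgebra n := fun α =>
    (mem_suAlgebra_iff _).2 ⟨SUNBakryEmery.frame_conjTranspose α, SUNBakryEmery.frame_trace hN α⟩
  calc ∑ a, B.T a * B.T a
      = ∑ a, B.T a * ∑ α, (-(SUNBakryEmery.frame α * B.T a).trace.re) • SUNBakryEmery.frame α :=
        Finset.sum_congr rfl fun a _ => congrArg (B.T a * ·) (h1 a)
    _ = ∑ α, (∑ a, (-(SUNBakryEmery.frame α * B.T a).trace.re) • B.T a) * SUNBakryEmery.frame α := by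
        simp_rw [Matrix.mul_sum, Matrix.mul_smul, Matrix.sum_mul, Matrix.smul_mul]
        rw [Finset.sum_comm]
    _ = ∑ α, ((1 / 2 : ℂ) • SUNBakryEmery.frame (N := n) α) * SUNBakryEmery.frame α := by
        refine Finset.sum_congr rfl fun α _ => ?_
        rw [B.sum_re_trace_smul (h2 α)]
    _ = (1 / 2 : ℂ) • ∑ α, SUNBakryEmery.frame (N := n) α * SUNBakryEmery.frame α := by
        rw [Finset.smul_sum]
        simp_rw [Matrix.smul_mul]
    _ = (-(((n : ℝ) ^ 2 - 1) / (2 * n))) • (1 : Matrix (Fin n) (Fin n) ℂ) := by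
        rw [SUNBakryEmery.sum_frame_mul_frame hN, smul_neg, smul_smul, ← neg_smul, ← Complex.coe_smul]
        congr 1
        have hn' : (n : ℂ) ≠ 0 := Nat.cast_ne_zero.2 hN
        push_cast
        field_simp

/-! ## Link derivatives of `Re tr(P · W(e) · Q)` and `Re tr(P · W(e)ᴴ · Q)` -/

/-- `∂_{e,X} Re tr(P W(e) Q) = Re tr(P X W(e) Q)` when `P`, `Q` do not read the link `e` (eq. (2.2) applied to a
matrix element). [cite: Luscher2010Trivializing, §2.2 eq. (2.2)] -/
theorem linkDeriv_re_trace_mul (e : Edge d L) (X : Matrix (Fin n) (Fin n) ℂ)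
    (P Q : AmbConfig d L n → Matrix (Fin n) (Fin n) ℂ)
    (hP : ∀ W Y, P (Function.update W e Y) = P W) (hQ : ∀ W Y, Q (Function.update W e Y) = Q W)
    (W : AmbConfig d L n) :
    linkDeriv e X (fun V => (P V * V e * Q V).trace.re) W = (P W * (X * W e) * Q W).trace.re := by
  unfold linkDeriv
  simp only [hP, hQ, Function.update_self]
  have h := hasDerivAt_re_trace_mul_exp (P W) X (W e * Q W) 0
  rw [zero_smul, NormedSpace.exp_zero, mul_one] at h
  have hfun : (fun s : ℝ => (P W * (NormedSpace.exp ((s : ℂ) • X) * W e) * Q W).trace.re) =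
      fun s : ℝ => (P W * (NormedSpace.exp (s • X) * (W e * Q W))).trace.re := by
    funext s
    rw [Complex.coe_smul]
    simp only [Matrix.mul_assoc]
  rw [hfun, h.deriv]
  simp only [Matrix.mul_assoc]

/-- `∂_{e,X} Re tr(P W(e)ᴴ Q) = Re tr(P W(e)ᴴ Xᴴ Q)` when `P`, `Q` do not read the link `e`
(`(e^{sX}W)ᴴ = Wᴴ e^{sXᴴ}`). [cite: Luscher2010Trivializing, §2.2 eq. (2.2)] -/
theorem linkDeriv_re_trace_conjTranspose_mul (e : Edge d L) (X : Matrix (Fin n) (Fin n) ℂ)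
    (P Q : AmbConfig d L n → Matrix (Fin n) (Fin n) ℂ)
    (hP : ∀ W Y, P (Function.update W e Y) = P W) (hQ : ∀ W Y, Q (Function.update W e Y) = Q W)
    (W : AmbConfig d L n) :
    linkDeriv e X (fun V => (P V * (V e)ᴴ * Q V).trace.re) W = (P W * ((W e)ᴴ * Xᴴ) * Q W).trace.re := by
  unfold linkDeriv
  simp only [hP, hQ, Function.update_self]
  have h := hasDerivAt_re_trace_mul_exp (P W * (W e)ᴴ) Xᴴ (Q W) 0
  rw [zero_smul, NormedSpace.exp_zero, mul_one] at h
  have hfun : (fun s : ℝ => (P W * (NormedSpace.exp ((s : ℂ) • X) * W e)ᴴ * Q W).trace.re) =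
      fun s : ℝ => (P W * (W e)ᴴ * (NormedSpace.exp (s • Xᴴ) * Q W)).trace.re := by
    funext s
    rw [Matrix.conjTranspose_mul, ← Matrix.exp_conjTranspose, Matrix.conjTranspose_smul, Complex.star_def,
      Complex.conj_ofReal, Complex.coe_smul]
    simp only [Matrix.mul_assoc]
  rw [hfun, h.deriv]
  simp only [Matrix.mul_assoc]

/-- A function that does not read the link `e` has `∂_{e,X} f = 0`. [cite: Luscher2010Trivializing, §2.2 eq. (2.2)] -/
theorem linkDeriv_eq_zero_of_update (e : Edge d L) (X : Matrix (Fin n) (Fin n) ℂ) (f : AmbConfig d L n → ℝ)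
    (hf : ∀ W Y, f (Function.update W e Y) = f W) (W : AmbConfig d L n) : linkDeriv e X f W = 0 := by
  unfold linkDeriv
  simp only [hf, deriv_const]

/-- `∑ₐ ∂ᵃₑ∂ᵃₑ Re tr(P W(e) Q) = -C_F Re tr(P W(e) Q)` (`P`, `Q` not reading `e`): the two derivatives insert
`∑ₐ TᵃTᵃ = -C_F` in front of `W(e)`. [cite: Luscher2010Trivializing, §4.4 (before eq. (4.18)), App. A eq. (A.5)] -/
theorem sum_linkDeriv_linkDeriv_re_trace_mul [NeZero L] (B : SuBasis n) (e : Edge d L)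
    (P Q : AmbConfig d L n → Matrix (Fin n) (Fin n) ℂ)
    (hP : ∀ W Y, P (Function.update W e Y) = P W) (hQ : ∀ W Y, Q (Function.update W e Y) = Q W)
    (W : AmbConfig d L n) :
    ∑ a, linkDeriv e (B.T a) (linkDeriv e (B.T a) (fun V => (P V * V e * Q V).trace.re)) W =
      -(((n : ℝ) ^ 2 - 1) / (2 * n)) * (P W * W e * Q W).trace.re := by
  have inner : ∀ a, linkDeriv e (B.T a) (fun V => (P V * V e * Q V).trace.re) =
      fun V => ((fun V => P V * B.T a) V * V e * Q V).trace.re := by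
    intro a
    funext V
    rw [linkDeriv_re_trace_mul e (B.T a) P Q hP hQ V]
    simp only [Matrix.mul_assoc]
  have outer : ∀ a, linkDeriv e (B.T a) (linkDeriv e (B.T a) (fun V => (P V * V e * Q V).trace.re)) W =
      (P W * (B.T a * B.T a) * (W e * Q W)).trace.re := by
    intro a
    rw [inner a, linkDeriv_re_trace_mul e (B.T a) (fun V => P V * B.T a) Q (fun V Y => by simp only [hP]) hQ W]
    simp only [Matrix.mul_assoc]
  simp_rw [outer]
  rw [← Complex.re_sum, ← Matrix.trace_sum, ← Finset.sum_mul, ← Matrix.mul_sum, B.sum_mul_self,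
    Matrix.mul_smul, Matrix.mul_one, Matrix.smul_mul, Matrix.trace_smul, Complex.smul_re, smul_eq_mul]
  simp only [Matrix.mul_assoc]

/-- Conjugate-transposed link: `∑ₐ ∂ᵃₑ∂ᵃₑ Re tr(P W(e)ᴴ Q) = -C_F Re tr(P W(e)ᴴ Q)` (`(Tᵃ)ᴴ(Tᵃ)ᴴ = TᵃTᵃ`).
[cite: Luscher2010Trivializing, §4.4 (before eq. (4.18)), App. A eq. (A.5)] -/
theorem sum_linkDeriv_linkDeriv_re_trace_conjTranspose_mul [NeZero L] (B : SuBasis n) (e : Edge d L)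
    (P Q : AmbConfig d L n → Matrix (Fin n) (Fin n) ℂ)
    (hP : ∀ W Y, P (Function.update W e Y) = P W) (hQ : ∀ W Y, Q (Function.update W e Y) = Q W)
    (W : AmbConfig d L n) :
    ∑ a, linkDeriv e (B.T a) (linkDeriv e (B.T a) (fun V => (P V * (V e)ᴴ * Q V).trace.re)) W =
      -(((n : ℝ) ^ 2 - 1) / (2 * n)) * (P W * (W e)ᴴ * Q W).trace.re := by
  have hT : ∀ a, (B.T a)ᴴ = -B.T a := fun a => ((mem_suAlgebra_iff _).1 (B.mem a)).1
  have inner : ∀ a, linkDeriv e (B.T a) (fun V => (P V * (V e)ᴴ * Q V).trace.re) =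
      fun V => (P V * (V e)ᴴ * (fun V => (B.T a)ᴴ * Q V) V).trace.re := by
    intro a
    funext V
    rw [linkDeriv_re_trace_conjTranspose_mul e (B.T a) P Q hP hQ V]
    simp only [Matrix.mul_assoc]
  have outer : ∀ a, linkDeriv e (B.T a) (linkDeriv e (B.T a) (fun V => (P V * (V e)ᴴ * Q V).trace.re)) W =
      (P W * (W e)ᴴ * (B.T a * B.T a) * Q W).trace.re := by
    intro a
    rw [inner a, linkDeriv_re_trace_conjTranspose_mul e (B.T a) P (fun V => (B.T a)ᴴ * Q V) hP
      (fun V Y => by simp only [hQ]) W, hT a]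
    simp only [Matrix.mul_assoc, Matrix.neg_mul, Matrix.mul_neg, neg_neg]
  simp_rw [outer]
  rw [← Complex.re_sum, ← Matrix.trace_sum, ← Finset.sum_mul, ← Matrix.mul_sum, B.sum_mul_self,
    Matrix.mul_smul, Matrix.mul_one, Matrix.smul_mul, Matrix.trace_smul, Complex.smul_re, smul_eq_mul]

/-! ## The plaquette Laplacian -/

/-- On a periodic lattice with `L ≥ 2` a shifted site differs from the site (private helper). [folklore] -/
private theorem shift_ne_self [NeZero L] (hL : 2 ≤ L) (x : Site d L) (i : Fin d) : x.shift i ≠ x := by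
  intro h
  have h1 := congr_fun h i
  simp only [Site.shift, Pi.add_apply, Pi.single_eq_same, add_eq_left] at h1
  haveI : Fact (1 < L) := ⟨hL⟩
  exact one_ne_zero h1

/-- **The plaquette is an eigenfunction of the link Laplacian**: for `L ≥ 2`, `μ ≠ ν` and every ambient
configuration `W`, `Δ Re tr(W(x,μ)W(x+μ̂,ν)W(x+ν̂,μ)ᴴW(x,ν)ᴴ) = 4 C_F Re tr(W(x,μ)W(x+μ̂,ν)W(x+ν̂,μ)ᴴW(x,ν)ᴴ)`,
`Δ = -∑ₑ∑ₐ∂ᵃₑ∂ᵃₑ`, `C_F = (n²-1)/(2n)`. The four links are pairwise distinct (this is where `L ≥ 2` enters), each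
contributes `-C_F Re tr(…)` by the two previous lemmas, every other link contributes `0`.
[cite: Luscher2010Trivializing, §3.3 eq. (3.10), §4.4 eq. (4.14)] -/
theorem linkLap_re_trace_plaquette [NeZero L] (hL : 2 ≤ L) (B : SuBasis n) (W : AmbConfig d L n)
    (x : Site d L) {μ ν : Fin d} (hμν : μ ≠ ν) :
    linkLap B (fun V => (V (x, μ) * V (x.shift μ, ν) * (V (x.shift ν, μ))ᴴ * (V (x, ν))ᴴ).trace.re) W =
      4 * (((n : ℝ) ^ 2 - 1) / (2 * n)) *
        (W (x, μ) * W (x.shift μ, ν) * (W (x.shift ν, μ))ᴴ * (W (x, ν))ᴴ).trace.re := by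
  set e₁ : Edge d L := (x, μ) with he₁
  set e₂ : Edge d L := (x.shift μ, ν) with he₂
  set e₃ : Edge d L := (x.shift ν, μ) with he₃
  set e₄ : Edge d L := (x, ν) with he₄
  have h12 : e₁ ≠ e₂ := fun h => hμν (congrArg Prod.snd h)
  have h13 : e₁ ≠ e₃ := fun h => shift_ne_self hL x ν (congrArg Prod.fst h).symm
  have h14 : e₁ ≠ e₄ := fun h => hμν (congrArg Prod.snd h)
  have h23 : e₂ ≠ e₃ := fun h => hμν (congrArg Prod.snd h).symm
  have h24 : e₂ ≠ e₄ := fun h => shift_ne_self hL x μ (congrArg Prod.fst h)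
  have h34 : e₃ ≠ e₄ := fun h => hμν (congrArg Prod.snd h)
  set f : AmbConfig d L n → ℝ := fun V => (V e₁ * V e₂ * (V e₃)ᴴ * (V e₄)ᴴ).trace.re with hf
  set g : Edge d L → ℝ := fun e => ∑ a, linkDeriv e (B.T a) (linkDeriv e (B.T a) f) W with hg
  -- links off the plaquette contribute nothing
  have hzero : ∀ e, e ≠ e₁ → e ≠ e₂ → e ≠ e₃ → e ≠ e₄ → g e = 0 := by
    intro e n1 n2 n3 n4
    have hfe : ∀ V Y, f (Function.update V e Y) = f V := by
      intro V Y
      simp only [hf, Function.update_of_ne n1.symm, Function.update_of_ne n2.symm,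
        Function.update_of_ne n3.symm, Function.update_of_ne n4.symm]
    have hin : ∀ a, linkDeriv e (B.T a) f = fun _ => 0 := fun a =>
      funext fun V => linkDeriv_eq_zero_of_update e (B.T a) f hfe V
    simp only [hg, hin]
    exact Finset.sum_eq_zero fun a _ => linkDeriv_eq_zero_of_update e (B.T a) _ (fun _ _ => rfl) W
  -- the four links of the plaquette
  have hg1 : g e₁ = -(((n : ℝ) ^ 2 - 1) / (2 * n)) * (W e₁ * W e₂ * (W e₃)ᴴ * (W e₄)ᴴ).trace.re := by
    have hf1 : f = fun V => ((fun _ => (1 : Matrix (Fin n) (Fin n) ℂ)) V * V e₁ *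
        (fun V => V e₂ * (V e₃)ᴴ * (V e₄)ᴴ) V).trace.re := by
      funext V; simp only [hf, Matrix.one_mul, Matrix.mul_assoc]
    rw [hg]; dsimp only; rw [hf1, sum_linkDeriv_linkDeriv_re_trace_mul B e₁ _ _ (fun V Y => rfl)
      (fun V Y => by simp only [Function.update_of_ne h12.symm, Function.update_of_ne h13.symm,
        Function.update_of_ne h14.symm]) W]
    simp only [Matrix.one_mul, Matrix.mul_assoc]
  have hg2 : g e₂ = -(((n : ℝ) ^ 2 - 1) / (2 * n)) * (W e₁ * W e₂ * (W e₃)ᴴ * (W e₄)ᴴ).trace.re := by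
    have hf2 : f = fun V => ((fun V => V e₁) V * V e₂ * (fun V => (V e₃)ᴴ * (V e₄)ᴴ) V).trace.re := by
      funext V; simp only [hf, Matrix.mul_assoc]
    rw [hg]; dsimp only; rw [hf2, sum_linkDeriv_linkDeriv_re_trace_mul B e₂ _ _
      (fun V Y => by simp only [Function.update_of_ne h12])
      (fun V Y => by simp only [Function.update_of_ne h23.symm, Function.update_of_ne h24.symm]) W]
    simp only [Matrix.mul_assoc]
  have hg3 : g e₃ = -(((n : ℝ) ^ 2 - 1) / (2 * n)) * (W e₁ * W e₂ * (W e₃)ᴴ * (W e₄)ᴴ).trace.re := by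
    have hf3 : f = fun V => ((fun V => V e₁ * V e₂) V * (V e₃)ᴴ * (fun V => (V e₄)ᴴ) V).trace.re := by
      funext V; simp only [hf]
    rw [hg]; dsimp only; rw [hf3, sum_linkDeriv_linkDeriv_re_trace_conjTranspose_mul B e₃ _ _
      (fun V Y => by simp only [Function.update_of_ne h13, Function.update_of_ne h23])
      (fun V Y => by simp only [Function.update_of_ne h34.symm]) W]
  have hg4 : g e₄ = -(((n : ℝ) ^ 2 - 1) / (2 * n)) * (W e₁ * W e₂ * (W e₃)ᴴ * (W e₄)ᴴ).trace.re := by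
    have hf4 : f = fun V => ((fun V => V e₁ * V e₂ * (V e₃)ᴴ) V * (V e₄)ᴴ *
        (fun _ => (1 : Matrix (Fin n) (Fin n) ℂ)) V).trace.re := by
      funext V; simp only [hf, Matrix.mul_one]
    rw [hg]; dsimp only; rw [hf4, sum_linkDeriv_linkDeriv_re_trace_conjTranspose_mul B e₄ _ _
      (fun V Y => by simp only [Function.update_of_ne h14, Function.update_of_ne h24,
        Function.update_of_ne h34]) (fun V Y => rfl) W]
    simp only [Matrix.mul_one]
  -- assemble
  have hsum : ∑ e, g e = g e₁ + g e₂ + g e₃ + g e₄ := by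
    rw [← Finset.sum_subset (Finset.subset_univ ({e₁, e₂, e₃, e₄} : Finset (Edge d L)))
      (fun e _ he => by
        simp only [Finset.mem_insert, Finset.mem_singleton, not_or] at he
        exact hzero e he.1 he.2.1 he.2.2.1 he.2.2.2)]
    rw [Finset.sum_insert (by simp [h12, h13, h14]), Finset.sum_insert (by simp [h23, h24]),
      Finset.sum_insert (by simp [h34]), Finset.sum_singleton]
    ring
  unfold linkLap
  change -(∑ e, g e) = _
  rw [hsum, hg1, hg2, hg3, hg4]
  ring

/-- **`PlaquetteLaplacian` holds** (file B's cited Prop is a theorem): `Δ Re tr U_p = 4 C_F Re tr U_p` on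
`SU(n)`-valued configurations, `L ≥ 2`. [cite: Luscher2010Trivializing, §3.3 eq. (3.10), §4.4 eq. (4.14)] -/
theorem plaquetteLaplacian_holds : PlaquetteLaplacian d L n := by
  intro _ hL B U x μ ν hμν
  rw [linkLap_re_trace_plaquette hL B _ x hμν]
  simp only [WilsonFlow.coeConfig_apply, plaquetteHolonomy, WilsonFlow.coe_mul_SU, WilsonFlow.coe_inv_SU]

end Literature.MathematicalPhysics.QuantumFieldTheory.Luscher2010
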